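import Mathlib
import Summits.ValiantsHypothesis.ValiantsHypothesis.Theorems.BinomialElusiveBinomialCandidateCorankTwoIteration

/-!
# Crux `BinomialElusive.BinomialCandidate` (stmt-ValiantsHypothesis-7392), line `registered`,
# skeleton v6 — stub `stub_nondegenerateCorankTwo`, piece C (wave 4): Picard elimination with
# two kernel variables, with freeness from the special target variables

This file proves the registered helper stub `corankTwo_iteration_v2`: the landed
`corankTwo_iteration` (file `…CorankTwoIteration`) with ONE extra exported conjunct, the
FREENESS of `F_a + W_a` from the three special target variables `W_0, W_1, W_2` (inner indices
`some 0, some 1, some 2`): every coefficient `e` of every `X₂^j`-coefficient of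
`F_a + Polynomial.C (X (some a))` vanishes as soon as `e (some 0) ≠ 0 ∨ e (some 1) ≠ 0 ∨
e (some 2) ≠ 0`.

Since the witnesses of `corankTwo_iteration` are hidden behind its `∃`, the construction is
re-run verbatim (same Picard iterates `Φ_K`, `K = G + d₁ + 1`, same embedding
`MvPolynomial.optionEquivLeft ∘ MvPolynomial.rename r` with `r 1 = none`, `r 0 = some none`,
`r (j'+2) = some (some (j'+3))`, same kernel-plane restriction `killCompl`), reusing the landed
helpers `CorankTwoIteration.eval₂_optionEquivLeft_rename`,
`CorankTwoIteration.coeff_optionEquivLeft_rename_eq_zero`,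
`CorankTwoIteration.coeff_optionEquivLeft_rename_single` and the `JetReduction.*` estimates.
The new conjunct: `F_a + W_a = optionEquivLeft (rename r (B_a(Φ_K)))`, and the image of `r`
avoids `some (some b)` for `b < 3`, so `coeff_optionEquivLeft_rename_eq_zero` applies.
-/


-- layout Summits/ValiantsHypothesis/ValiantsHypothesis forces the duplicated namespace component
set_option linter.dupNamespace false

noncomputable section

namespace Summit.ValiantsHypothesis.ValiantsHypothesis.Theorems.BinomialCandidateStubs

open scoped BigOperators
open MvPolynomial

open CorankTwoIteration in
/-- **Elimination of the regular coordinates with two kernel variables, with freeness from the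
special target variables** (piece C of the stub `stub_nondegenerateCorankTwo`, version 2).  In
the corank-two normal form (`B_i` without monomials of degree `< 2`; `q`, `T` of positive order;
`q_{j'+2} + B_{j'+3}(q) = T_{j'+3}`, `B_a(q) = T_a` for `a = 0, 1, 2`), for all `G, d₁` there are
`F₀, F₁, F₂ ∈ ℂ[W, X₁][X₂]` and a jet `φ : Fin n₀ → ℂ[X₁, X₂]` with `F_a + W_a` free of
`W_0, W_1, W_2`, `F_a(T; q_0, q_1) ≡ 0 (mod t^G)`, `W`-linear part `-W_a`, pure part
`F_a(0; X) = B_a(X₁, X₂, φ(X))` coefficientwise, `φ = O(degree 2)` and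
`φ_{j'} + B_{j'+3}(X₁, X₂, φ) ≡ 0` up to degree `d₁`. -/
theorem corankTwo_iteration_v2 :
    ∀ (n₀ G d₁ : ℕ) (B : Fin (n₀ + 3) → MvPolynomial (Fin (n₀ + 2)) ℂ)
      (q : Fin (n₀ + 2) → LaurentSeries ℂ) (T : Fin (n₀ + 3) → LaurentSeries ℂ),
      (∀ i, ∀ d : Fin (n₀ + 2) →₀ ℕ, d.degree < 2 → MvPolynomial.coeff d (B i) = 0) →
      (∀ j, ∀ g : ℤ, g < 1 → (q j).coeff g = 0) →
      (∀ i, ∀ g : ℤ, g < 1 → (T i).coeff g = 0) →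
      (∀ j' : Fin n₀,
        q j'.succ.succ + MvPolynomial.aeval q (B j'.succ.succ.succ) = T j'.succ.succ.succ) →
      MvPolynomial.aeval q (B 0) = T 0 → MvPolynomial.aeval q (B 1) = T 1 →
      MvPolynomial.aeval q (B 2) = T 2 →
      ∃ (F₀ F₁ F₂ : Polynomial (MvPolynomial (Option (Fin (n₀ + 3))) ℂ))
        (φ : Fin n₀ → MvPolynomial (Fin 2) ℂ),
        (∀ (j : ℕ) (e : Option (Fin (n₀ + 3)) →₀ ℕ),
          (e (some 0) ≠ 0 ∨ e (some 1) ≠ 0 ∨ e (some 2) ≠ 0) →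
          MvPolynomial.coeff e ((F₀ + Polynomial.C (MvPolynomial.X (some 0))).coeff j) = 0 ∧
          MvPolynomial.coeff e ((F₁ + Polynomial.C (MvPolynomial.X (some 1))).coeff j) = 0 ∧
          MvPolynomial.coeff e ((F₂ + Polynomial.C (MvPolynomial.X (some 2))).coeff j) = 0) ∧
        (∀ g : ℤ, g < G → (Polynomial.eval₂ (MvPolynomial.aeval
          (fun o : Option (Fin (n₀ + 3)) => Option.elim o (q 0) T)).toRingHom (q 1) F₀).coeff g = 0) ∧
        (∀ g : ℤ, g < G → (Polynomial.eval₂ (MvPolynomial.aeval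
          (fun o : Option (Fin (n₀ + 3)) => Option.elim o (q 0) T)).toRingHom (q 1) F₁).coeff g = 0) ∧
        (∀ g : ℤ, g < G → (Polynomial.eval₂ (MvPolynomial.aeval
          (fun o : Option (Fin (n₀ + 3)) => Option.elim o (q 0) T)).toRingHom (q 1) F₂).coeff g = 0) ∧
        (MvPolynomial.coeff (Finsupp.single (some 0) 1) (F₀.coeff 0) = -1 ∧
          MvPolynomial.coeff (Finsupp.single (some 1) 1) (F₀.coeff 0) = 0 ∧
          MvPolynomial.coeff (Finsupp.single (some 2) 1) (F₀.coeff 0) = 0 ∧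
          MvPolynomial.coeff (Finsupp.single (some 0) 1) (F₁.coeff 0) = 0 ∧
          MvPolynomial.coeff (Finsupp.single (some 1) 1) (F₁.coeff 0) = -1 ∧
          MvPolynomial.coeff (Finsupp.single (some 2) 1) (F₁.coeff 0) = 0 ∧
          MvPolynomial.coeff (Finsupp.single (some 0) 1) (F₂.coeff 0) = 0 ∧
          MvPolynomial.coeff (Finsupp.single (some 1) 1) (F₂.coeff 0) = 0 ∧
          MvPolynomial.coeff (Finsupp.single (some 2) 1) (F₂.coeff 0) = -1) ∧
        (∀ i j : ℕ, MvPolynomial.coeff (Finsupp.single none i) (F₀.coeff j) =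
            MvPolynomial.coeff (Finsupp.single 0 i + Finsupp.single 1 j)
              (MvPolynomial.aeval (Fin.cons (MvPolynomial.X 0) (Fin.cons (MvPolynomial.X 1) φ) :
                Fin (n₀ + 2) → MvPolynomial (Fin 2) ℂ) (B 0)) ∧
          MvPolynomial.coeff (Finsupp.single none i) (F₁.coeff j) =
            MvPolynomial.coeff (Finsupp.single 0 i + Finsupp.single 1 j)
              (MvPolynomial.aeval (Fin.cons (MvPolynomial.X 0) (Fin.cons (MvPolynomial.X 1) φ) :
                Fin (n₀ + 2) → MvPolynomial (Fin 2) ℂ) (B 1)) ∧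
          MvPolynomial.coeff (Finsupp.single none i) (F₂.coeff j) =
            MvPolynomial.coeff (Finsupp.single 0 i + Finsupp.single 1 j)
              (MvPolynomial.aeval (Fin.cons (MvPolynomial.X 0) (Fin.cons (MvPolynomial.X 1) φ) :
                Fin (n₀ + 2) → MvPolynomial (Fin 2) ℂ) (B 2))) ∧
        (∀ j', ∀ e : Fin 2 →₀ ℕ, e.degree < 2 → MvPolynomial.coeff e (φ j') = 0) ∧
        (∀ j' : Fin n₀, ∀ e : Fin 2 →₀ ℕ, e.degree ≤ d₁ →
          MvPolynomial.coeff e (φ j' + MvPolynomial.aeval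
            (Fin.cons (MvPolynomial.X 0) (Fin.cons (MvPolynomial.X 1) φ) :
                Fin (n₀ + 2) → MvPolynomial (Fin 2) ℂ)
              (B j'.succ.succ.succ)) = 0) := by
  intro n₀ G d₁ B q T hB hq hT hreg h0 h1 h2
  -- the `t`-adic filtration of `ℂ((t))`
  have hF := JetReduction.laurentGE_isFilt
  set F : ℕ → LaurentSeries ℂ → Prop := fun m z => ∀ g : ℤ, g < m → z.coeff g = 0 with hFdef
  -- the fixed-point system `q_j = W_j - B'_j(q)` on all `n₀ + 2` source variables
  -- (both kernel slots free)
  set Bs : Fin (n₀ + 2) → MvPolynomial (Fin (n₀ + 2)) ℂ :=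
    Fin.cons 0 (Fin.cons 0 fun j' => B j'.succ.succ.succ) with hBs_def
  set W : Fin (n₀ + 2) → LaurentSeries ℂ :=
    Fin.cons (q 0) (Fin.cons (q 1) fun j' => T j'.succ.succ.succ) with hW_def
  have hBs : ∀ j, ∀ d : Fin (n₀ + 2) →₀ ℕ, d.degree < 2 → coeff d (Bs j) = 0 := fun j =>
    Fin.cases (fun d _ => by simp [hBs_def]) (fun i => Fin.cases (fun d _ => by simp [hBs_def])
      (fun j' => by simpa [hBs_def] using hB j'.succ.succ.succ) i) j
  have hq' : ∀ j, F 1 (q j) := fun j g hg => hq j g (by exact_mod_cast hg)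
  have hT' : ∀ i, F 1 (T i) := fun i g hg => hT i g (by exact_mod_cast hg)
  have hW : ∀ j, F 1 (W j) := fun j =>
    Fin.cases (by simpa [hW_def] using hq' 0) (fun i => Fin.cases (by simpa [hW_def] using hq' 1)
      (fun j' => by simpa [hW_def] using hT' j'.succ.succ.succ) i) j
  have hfix : ∀ j, q j = W j - aeval q (Bs j) := fun j =>
    Fin.cases (by simp [hW_def, hBs_def]) (fun i => Fin.cases (by simp [hW_def, hBs_def])
      (fun j' => by simp only [hW_def, hBs_def, Fin.cons_succ]; rw [← hreg j']; ring) i) j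
  -- the Picard iterates
  set Φ : ℕ → Fin (n₀ + 2) → MvPolynomial (Fin (n₀ + 2)) ℂ :=
    fun m => (fun (Ψ : Fin (n₀ + 2) → MvPolynomial (Fin (n₀ + 2)) ℂ) (j : Fin (n₀ + 2)) =>
      X j - aeval Ψ (Bs j))^[m] X with hΦdef
  have hΦ0 : ∀ j, Φ 0 j = X j := fun j => rfl
  have hΦ : ∀ m j, Φ (m + 1) j = X j - aeval (Φ m) (Bs j) := fun m j => by
    simp only [hΦdef, Function.iterate_succ_apply']
  -- the iterates keep the kernel coordinates (as `B'_0 = B'_1 = 0`)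
  have hΦzero : ∀ m, Φ m 0 = X 0 := by
    intro m
    induction m with
    | zero => exact hΦ0 0
    | succ m _ => rw [hΦ]; simp [hBs_def]
  have hΦone : ∀ m, Φ m 1 = X 1 := by
    intro m
    induction m with
    | zero => exact hΦ0 1
    | succ m _ => rw [hΦ]; simp [hBs_def]
  -- successive iterates agree to increasing order: `Φ_{m+1} ≡ Φ_m (mod degree ≥ m + 2)`
  have hdiff : ∀ m j, ∀ e : Fin (n₀ + 2) →₀ ℕ, e.degree < m + 2 →
      coeff e (Φ (m + 1) j - Φ m j) = 0 := by
    intro m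
    induction m with
    | zero =>
      intro j e he
      rw [hΦ, hΦ0, sub_sub_cancel_left, coeff_neg, neg_eq_zero]
      exact JetReduction.aeval_degGE (hBs j) (JetReduction.iter_degGE_one hBs hΦ0 hΦ 0) e
        (by omega)
    | succ m ih =>
      intro j
      rw [hΦ (m + 1) j, hΦ m j, sub_sub_sub_cancel_left]
      exact JetReduction.aeval_sub_aeval_degGE (t := m + 1) (hBs j)
        (JetReduction.iter_degGE_one hBs hΦ0 hΦ m)
        (JetReduction.iter_degGE_one hBs hΦ0 hΦ (m + 1))
        (fun i e he => by rw [← neg_sub, coeff_neg, ih i e (by omega), neg_zero])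
  -- CLAIM A: `q ≡ Φ_m(W)` to level `m + 2`
  have hA : ∀ m j, F (m + 2) (q j - aeval W (Φ m j)) :=
    JetReduction.filt_sub_aeval_iter hF hBs hΦ0 hΦ hq' hW hfix
  -- the polynomials `B_a(Φ_K)`, `K = G + d₁ + 1`
  set Gp : Fin (n₀ + 3) → MvPolynomial (Fin (n₀ + 2)) ℂ :=
    fun a => aeval (Φ (G + d₁ + 1)) (B a) with hGp_def
  -- CLAIM B: `B_a(Φ_K(W)) ≡ B_a(q)` to level `K + 3`
  have hBval : ∀ a, F (G + d₁ + 1 + 1 + 2) (aeval W (Gp a) - aeval q (B a)) := by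
    intro a
    rw [hGp_def, JetReduction.aeval_aeval]
    exact JetReduction.filt_aeval_sub_aeval hF (hB a)
      (fun j => JetReduction.filt_aeval_iter hF hBs hΦ0 hΦ hW (G + d₁ + 1) j) hq'
      (G + d₁ + 1 + 1)
      (fun j => by
        have h := hF.2.2.1 (G + d₁ + 1 + 2) _ (hA (G + d₁ + 1) j)
        rw [neg_sub] at h
        exact h)
  -- the embedding `ℂ[Y] → ℂ[W, X₁][X₂]`: `Y_1 ↦ X₂` (outer), `Y_0 ↦ X₁ = none`,
  -- `Y_{j'+2} ↦ W_{j'+3}`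
  obtain ⟨r, hr_def⟩ : ∃ r : Fin (n₀ + 2) → Option (Option (Fin (n₀ + 3))),
      r = Fin.cons (some none) (Fin.cons none fun j' => some (some j'.succ.succ.succ)) :=
    ⟨_, rfl⟩
  have hr0 : r 0 = some none := by rw [hr_def]; rfl
  have hr1 : r 1 = none := by rw [hr_def, Fin.cons_one, Fin.cons_zero]
  have hr : Function.Injective r := by
    rw [hr_def]
    refine Fin.cons_injective_of_injective ?_ (Fin.cons_injective_of_injective ?_ ?_)
    · rintro ⟨i, hi⟩
      revert hi
      refine Fin.cases ?_ (fun j' => ?_) i <;> simp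
    · rintro ⟨j', hj'⟩
      simp at hj'
    · intro a b h
      simpa [Fin.succ_inj] using h
  have hrange : ∀ b : Fin (n₀ + 3), b.val < 3 → some (some b) ∉ Set.range r := by
    rintro b hb ⟨i, hi⟩
    revert hi
    rw [hr_def]
    refine Fin.cases (by simp) (fun i' => Fin.cases (by simp) (fun j' h => ?_) i') i
    simp only [Fin.cons_succ, Option.some.injEq] at h
    have h' := congrArg Fin.val h
    simp only [Fin.val_succ] at h'
    omega
  have hrW : (fun i => (r i).elim (q 1) (fun o : Option (Fin (n₀ + 3)) => (o.elim (q 0) T))) =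
      W := by
    funext i
    rw [hr_def, hW_def]
    exact Fin.cases (by simp) (fun i' => Fin.cases (by simp) (fun j' => by simp) i') i
  -- the polynomials `F_a := embed(B_a(Φ_K)) - W_a`
  obtain ⟨Fa, hFa⟩ : ∃ Fa : Fin (n₀ + 3) → Polynomial (MvPolynomial (Option (Fin (n₀ + 3))) ℂ),
      ∀ a, Fa a = MvPolynomial.optionEquivLeft ℂ (Option (Fin (n₀ + 3)))
        (MvPolynomial.rename r (Gp a)) - Polynomial.C (X (some a)) := ⟨_, fun a => rfl⟩
  have hev : ∀ a, aeval q (B a) = T a → ∀ g : ℤ, g < G → (Polynomial.eval₂ (MvPolynomial.aeval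
      (fun o : Option (Fin (n₀ + 3)) => Option.elim o (q 0) T)).toRingHom (q 1) (Fa a)).coeff g =
        0 := by
    intro a ha g hg
    rw [hFa, Polynomial.eval₂_sub, eval₂_optionEquivLeft_rename, hrW, Polynomial.eval₂_C]
    have := hBval a g (by push_cast; omega)
    simpa [ha] using this
  have hlin : ∀ a b : Fin (n₀ + 3), b.val < 3 →
      MvPolynomial.coeff (Finsupp.single (some b) 1) ((Fa a).coeff 0) =
        if a = b then -1 else 0 := by
    intro a b hb
    classical
    rw [hFa, Polynomial.coeff_sub, coeff_sub,
      coeff_optionEquivLeft_rename_eq_zero r (Gp a) 0 (by simp) (hrange b hb),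
      Polynomial.coeff_C_zero, coeff_X, zero_sub]
    by_cases hab : a = b
    · subst hab; simp
    · rw [if_neg (fun h => hab ?_), if_neg hab, neg_zero]
      exact Option.some_injective _ (Finsupp.single_left_injective one_ne_zero h)
  have hpure : ∀ a (i j : ℕ), MvPolynomial.coeff (Finsupp.single none i) ((Fa a).coeff j) =
      coeff (Finsupp.single 0 i + Finsupp.single 1 j) (Gp a) := by
    intro a i j
    classical
    rw [hFa, Polynomial.coeff_sub, coeff_sub, coeff_optionEquivLeft_rename_single hr hr0 hr1,
      Polynomial.coeff_C, sub_eq_self]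
    split_ifs
    · rw [coeff_X, if_neg]
      intro h
      have h' := DFunLike.congr_fun h (some a)
      simp at h'
    · exact coeff_zero _
  -- the restriction to the kernel plane `ρ : ℂ[Y] → ℂ[X₁, X₂]`, `Y_0 ↦ X 0`, `Y_1 ↦ X 1`,
  -- `Y_{j'+2} ↦ 0`
  have h2le : 2 ≤ n₀ + 2 := Nat.le_add_left 2 n₀
  set ρ : MvPolynomial (Fin (n₀ + 2)) ℂ →ₐ[ℂ] MvPolynomial (Fin 2) ℂ :=
    MvPolynomial.killCompl (Fin.castLE_injective h2le) with hρ_def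
  have hρcoeff : ∀ (e : Fin 2 →₀ ℕ) (H : MvPolynomial (Fin (n₀ + 2)) ℂ),
      coeff e (ρ H) = coeff (e.mapDomain (Fin.castLE h2le)) H := fun e H =>
    MvPolynomial.coeff_killCompl _
  have hcast0 : Fin.castLE h2le (0 : Fin 2) = (0 : Fin (n₀ + 2)) := rfl
  have hcast1 : Fin.castLE h2le (1 : Fin 2) = (1 : Fin (n₀ + 2)) := rfl
  have hρX : ∀ k : Fin 2, ρ (X (Fin.castLE h2le k)) = X k := fun k => by
    simpa only [rename_X] using
      MvPolynomial.killCompl_rename_app (Fin.castLE_injective h2le) (X k : MvPolynomial (Fin 2) ℂ)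
  have hρXreg : ∀ j' : Fin n₀, ρ (X j'.succ.succ) = 0 := by
    intro j'
    simp only [hρ_def, MvPolynomial.killCompl, aeval_X]
    rw [dif_neg]
    rintro ⟨k, hk⟩
    have h' := congrArg Fin.val hk
    simp only [Fin.val_castLE, Fin.val_succ] at h'
    omega
  -- the kernel-surface jet: `φ_{j'} := ρ (Φ_K)_{j'+2}`
  obtain ⟨φ, hφ_def⟩ : ∃ φ : Fin n₀ → MvPolynomial (Fin 2) ℂ,
      φ = fun j' => ρ (Φ (G + d₁ + 1) j'.succ.succ) := ⟨_, rfl⟩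
  have hφ : ∀ j', φ j' = ρ (Φ (G + d₁ + 1) j'.succ.succ) := fun j' => by rw [hφ_def]
  have hcons : (Fin.cons (X 0) (Fin.cons (X 1) φ) : Fin (n₀ + 2) → MvPolynomial (Fin 2) ℂ) =
      fun i => ρ (Φ (G + d₁ + 1) i) := by
    funext i
    refine Fin.cases ?_ (fun i' => ?_) i
    · rw [Fin.cons_zero, hΦzero, ← hcast0, hρX]
    · refine Fin.cases ?_ (fun j' => ?_) i'
      · rw [Fin.cons_succ, Fin.cons_zero, Fin.succ_zero_eq_one, hΦone, ← hcast1, hρX]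
      · rw [Fin.cons_succ, Fin.cons_succ, hφ]
  have hcomp : ∀ H : MvPolynomial (Fin (n₀ + 2)) ℂ,
      aeval (Fin.cons (X 0) (Fin.cons (X 1) φ) : Fin (n₀ + 2) → MvPolynomial (Fin 2) ℂ) H =
        ρ (aeval (Φ (G + d₁ + 1)) H) := by
    intro H
    rw [hcons, ← MvPolynomial.comp_aeval, AlgHom.comp_apply]
  -- `φ = O(degree 2)`
  have h7 : ∀ j', ∀ e : Fin 2 →₀ ℕ, e.degree < 2 → coeff e (φ j') = 0 := by
    intro j' e he
    have hdeg : ∀ e' : Fin (n₀ + 2) →₀ ℕ, e'.degree < 2 →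
        coeff e' (aeval (Φ (G + d₁)) (Bs j'.succ.succ)) = 0 :=
      JetReduction.aeval_degGE (hBs _) (JetReduction.iter_degGE_one hBs hΦ0 hΦ _)
    have hφj : φ j' = -ρ (aeval (Φ (G + d₁)) (Bs j'.succ.succ)) := by
      rw [hφ, hΦ, map_sub, hρXreg, zero_sub]
    rw [hφj, coeff_neg, hρcoeff, hdeg _ (by rwa [Finsupp.degree_mapDomain]), neg_zero]
  -- the kernel-surface congruence `φ_{j'} + B_{j'+3}(X₁, X₂, φ) ≡ 0` up to degree `d₁`
  have h8 : ∀ j' : Fin n₀, ∀ e : Fin 2 →₀ ℕ, e.degree ≤ d₁ →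
      coeff e (φ j' + aeval (Fin.cons (X 0) (Fin.cons (X 1) φ) : Fin (n₀ + 2) →
        MvPolynomial (Fin 2) ℂ) (B j'.succ.succ.succ)) = 0 := by
    intro j' e he
    have hB' : B j'.succ.succ.succ = Bs j'.succ.succ := by simp [hBs_def]
    have key : φ j' + aeval (Fin.cons (X 0) (Fin.cons (X 1) φ) : Fin (n₀ + 2) →
        MvPolynomial (Fin 2) ℂ) (B j'.succ.succ.succ) =
        -ρ (Φ (G + d₁ + 1 + 1) j'.succ.succ - Φ (G + d₁ + 1) j'.succ.succ) := by
      rw [hcomp, hB', hΦ (G + d₁ + 1) j'.succ.succ, map_sub, map_sub, hρXreg, zero_sub, hφ]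
      ring
    rw [key, coeff_neg, hρcoeff,
      hdiff (G + d₁ + 1) j'.succ.succ _ (by rw [Finsupp.degree_mapDomain]; omega), neg_zero]
  -- the pure parts
  have hpure' : ∀ a (i j : ℕ), MvPolynomial.coeff (Finsupp.single none i) ((Fa a).coeff j) =
      coeff (Finsupp.single 0 i + Finsupp.single 1 j)
        (aeval (Fin.cons (X 0) (Fin.cons (X 1) φ) : Fin (n₀ + 2) → MvPolynomial (Fin 2) ℂ)
          (B a)) := by
    intro a i j
    rw [hpure, hcomp, hρcoeff, Finsupp.mapDomain_add, Finsupp.mapDomain_single,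
      Finsupp.mapDomain_single, hcast0, hcast1]
  have h01 : (0 : Fin (n₀ + 3)) ≠ 1 := Fin.zero_ne_one
  have h02 : (0 : Fin (n₀ + 3)) ≠ 2 := by rw [Ne, Fin.ext_iff, Fin.val_zero, Fin.val_two]; omega
  have h12 : (1 : Fin (n₀ + 3)) ≠ 2 := by rw [Ne, Fin.ext_iff, Fin.val_one, Fin.val_two]; omega
  have hv0 : (0 : Fin (n₀ + 3)).val < 3 := by rw [Fin.val_zero]; omega
  have hv1 : (1 : Fin (n₀ + 3)).val < 3 := by rw [Fin.val_one]; omega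
  have hv2 : (2 : Fin (n₀ + 3)).val < 3 := by rw [Fin.val_two]; omega
  -- the new conjunct: `F_a + W_a = embed(B_a(Φ_K))` is free of `W_0, W_1, W_2`
  have hfree : ∀ a b : Fin (n₀ + 3), b.val < 3 → ∀ (j : ℕ) (e : Option (Fin (n₀ + 3)) →₀ ℕ),
      e (some b) ≠ 0 → MvPolynomial.coeff e ((Fa a + Polynomial.C (X (some a))).coeff j) = 0 := by
    intro a b hb j e he
    rw [hFa, sub_add_cancel]
    exact coeff_optionEquivLeft_rename_eq_zero r (Gp a) j he (hrange b hb)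
  have hfree' : ∀ (a : Fin (n₀ + 3)) (j : ℕ) (e : Option (Fin (n₀ + 3)) →₀ ℕ),
      (e (some 0) ≠ 0 ∨ e (some 1) ≠ 0 ∨ e (some 2) ≠ 0) →
      MvPolynomial.coeff e ((Fa a + Polynomial.C (X (some a))).coeff j) = 0 := by
    intro a j e he
    rcases he with h | h | h
    · exact hfree a 0 hv0 j e h
    · exact hfree a 1 hv1 j e h
    · exact hfree a 2 hv2 j e h
  refine ⟨Fa 0, Fa 1, Fa 2, φ, fun j e he => ⟨hfree' 0 j e he, hfree' 1 j e he, hfree' 2 j e he⟩,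
    hev 0 h0, hev 1 h1, hev 2 h2, ⟨?_, ?_, ?_, ?_, ?_, ?_, ?_, ?_, ?_⟩,
    fun i j => ⟨hpure' 0 i j, hpure' 1 i j, hpure' 2 i j⟩, h7, h8⟩
  · rw [hlin 0 0 hv0, if_pos rfl]
  · rw [hlin 0 1 hv1, if_neg h01]
  · rw [hlin 0 2 hv2, if_neg h02]
  · rw [hlin 1 0 hv0, if_neg h01.symm]
  · rw [hlin 1 1 hv1, if_pos rfl]
  · rw [hlin 1 2 hv2, if_neg h12]
  · rw [hlin 2 0 hv0, if_neg h02.symm]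
  · rw [hlin 2 1 hv1, if_neg h12.symm]
  · rw [hlin 2 2 hv2, if_pos rfl]

end Summit.ValiantsHypothesis.ValiantsHypothesis.Theorems.BinomialCandidateStubs

end
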